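/-
M16b (decomp-mm-lens-5 g29) — CORRECTED DEFLATION.  The kernel-field condition `D_μ t ∈ I` is not
needed to deflate: it suffices to SUBTRACT from `D_μ t` its graph restriction `ρ_t ∈ ℂ[A,B]`
(`D_μ t − ι ρ_t ∈ I`), because `ρ_t(y) = 0` whenever `μ(y)` is TANGENT at `y`.  The ROW-SPLIT class
(every test has zero row or is `c`-affine; it contains the Freivalds-twisted squared systems, the
standing adversary of the kernel-field residual) deflates at cost `4·cost + n²` with NO kernel
field.  No sorry.
-/
import Mathlib
import Summits.MatrixMultiplication.Statement
import Summits.MatrixMultiplication.MatrixMultiplication.Theorems.GraphEquationsFlatDeflation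

/-!
# Graph equations — deflation with correction terms

Supporting kernels for the crux `MultiplicityReduction` of route `GraphEquations`
(line `purisplit`, stub `BoundedOrderPurification`, rung `K = 2`).

The deflation of `GraphEquationsDeflation` adds the tests `D_μ t` (`t` a test, `μ` a coefficient
field) and needs `μ` to be a KERNEL FIELD (`D_μ t ∈ I`) for the deflated system to stay correct.
Write `ρ_t := (D_μ t)|_{c = ab} ∈ ℂ[A,B]` for the graph restriction, the unique `ρ` with
`D_μ t − ι ρ ∈ I`.  The kernel-field condition is `ρ_t = 0`.  This file shows it can be replaced by
SUBTRACTING `ρ_t`: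

* `IdealInitIsolatedSet.transport` — **transport of order-`1` isolation under corrections that
  vanish at `y`.**  If `span S` is initially isolated to order `1` over `y`, `S' ⊆ I`, and every
  `s ∈ S` is `s' + ι σ` with `s' ∈ span S'` and `σ(y) = 0`, then `span S'` is initially isolated to
  order `1` over `y`.  (An isolating family `u_i = Σ c·s` is moved to `u'_i = Σ c·s'`; the
  coefficientwise specialisation `map (eval y) ∘ liftF` is a ring map killing every `ι σ`, so the
  specialised initial forms agree, and `u'_i ∈ I` supplies the vanishing `F`-constant term.)
* `EqSystem.IdealInitIsolatedAt.deflate_tangent_set` — the set-level form of `deflate_tangent`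
  (a tangent direction `γ ∈ ker J_C(graphPoint y)` deflating `span (tests ∪ D_μ tests)` to order `1`
  for every `μ` with `μ(y) = γ`).
* `EqSystem.IdealInitIsolatedAt.deflate_corrected` — **CORRECTED DEFLATION.**  For `E` correct with
  test ideal initially isolated to order `2` over `y` there is a tangent `γ` such that for every
  field `μ` with `μ(y) = γ` and all corrections `ρ_j ∈ ℂ[A,B]` with `D_μ t_j − ι ρ_j ∈ I`, every
  system containing the tests of `E` and the corrected tests `D_μ t_j − ι ρ_j` (those that are not
  `0`) has its test ideal initially isolated to order `1` over `y`.  The point: `D_μ t_j − ι ρ_j ∈ I`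
  forces `ρ_j(y) = (D_μ t_j)(graphPoint y) = (J_C(graphPoint y) γ)_j = 0`
  (`EqSystem.eval_correction_eq_zero`).  Such a system is CORRECT as soon as all its tests lie in
  `I` (`EqSystem.Correct.of_contains`) — no kernel-field condition.
* **The ROW-SPLIT class** (`EqSystem.RowSplit`: every test has ZERO ROW, `coeff_{F_q} Ψ⁻¹ t = 0` —
  e.g. `t ∈ I²` — or is `c`-AFFINE, `∂t/∂c_q ∈ ℂ[A,B]` — e.g. generator tests, Freivalds tests
  `x(a)ᵀ (C − AB) y(b)` with POLYNOMIAL vectors): `exists_reduced_corrDeflation_of_rowSplit` gives a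
  CORRECT deflation REDUCED at the graph point over `y` of cost `≤ 4·cost E + n²`: forward-mode AD
  along the constant tangent field `γ`, then DROP the deflated `c`-affine tests (their `D_γ t` is
  already in `ℂ[A,B]`, so the corrected test is `0`) — `EqSystem.restrictToIdeal`.  This class
  contains the FREIVALDS-TWISTED SQUARED SYSTEMS `{f_q²} ∪ {x_s(a)ᵀ F y_s(b) : s ≤ m}` (the natural
  adversary of `UniformKernelFieldDeflation` in the window `ω < β < β'`, previously handled on paper
  by a Cramer/adjugate kernel section of cost `O(m⁴ + m n²)`): they are deflated at cost
  `4·cost + n²` for EVERY number `m` of twisting rows, and they are in general neither flat nor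
  const-deflatable.  So the residual of hand 1 shrinks again: HIDDEN ∧ TWISTED ∧ ¬ROW-SPLIT, and the
  demanded object may be a pair (field `μ`, corrections `ρ`) — see `GraphEquationsCorrectedResidual`.
-/

-- dupNamespace: forced by the nested Summit.MatrixMultiplication.MatrixMultiplication layout (D-0017)
set_option linter.dupNamespace false

noncomputable section

open scoped BigOperators

namespace Summit.MatrixMultiplication.MatrixMultiplication.Theorems.GraphEquations

open MvPolynomial Literature.Computability.AlgebraicComplexity
open Literature.Computability.AlgebraicComplexity.ArithCircuit

variable {n : ℕ}

/-! ## Small algebra: `ι`, graph points, `D_μ` -/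

/-- `liftF (ι g) = C g`. -/
theorem liftF_liftAB (g : MvPolynomial (MatMulVars n) ℂ) : liftF n (liftAB n g) = C g := by
  rw [← substF_C, liftF_substF]

/-- `ι g` at the graph point over `y` is `g(y)`. -/
theorem eval_graphPoint_liftAB (y : MatMulVars n → ℂ) (g : MvPolynomial (MatMulVars n) ℂ) :
    eval (graphPoint y) (liftAB n g) = eval y g := by
  rw [← substF_C, eval_graphPoint_substF, constantCoeff_C]

/-- `(D_μ t)(graphPoint y) = Σ_q μ_q(y) · (∂t/∂c_q)(graphPoint y)`. -/
theorem eval_graphPoint_derivC (y : MatMulVars n → ℂ) (μ : Fin n × Fin n → MvPolynomial (MatMulVars n) ℂ)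
    (t : MvPolynomial (GraphVars n) ℂ) :
    eval (graphPoint y) (derivC μ t) =
      ∑ q, eval y (μ q) * eval (graphPoint y) (pderiv (Sum.inr q) t) := by
  unfold derivC
  simp only [map_sum, map_mul, eval_graphPoint_liftAB]

namespace EqSystem

/-- If `μ(y) = γ` is TANGENT at `y` (`γ ∈ ker J_C(graphPoint y)`), then `D_μ t` vanishes at the
graph point over `y` for every test `t`. -/
theorem eval_graphPoint_derivC_eq_zero_of_tangent {E : EqSystem n} {y : MatMulVars n → ℂ}
    {γ : Fin n × Fin n → ℂ} (hγ : (E.jacobianC (graphPoint y)).mulVec γ = 0)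
    {μ : Fin n × Fin n → MvPolynomial (MatMulVars n) ℂ} (hμ : ∀ q, eval y (μ q) = γ q)
    {j : ℕ} (hj : j ∈ E.tests) : eval (graphPoint y) (derivC μ (E.testPoly j)) = 0 := by
  have h := (E.jacobianC_graphPoint_mulVec_eq_zero_iff y γ).mp hγ j hj
  rw [eval_map_homogeneousComponent_one_liftF] at h
  rw [eval_graphPoint_derivC]
  simp only [hμ]
  simpa only [mul_comm] using h

/-- **Corrections vanish at `y`.**  If `μ(y)` is tangent at `y` and `D_μ t_j − ι ρ_j ∈ I`, then
`ρ_j(y) = 0`. -/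
theorem eval_correction_eq_zero {E : EqSystem n} {y : MatMulVars n → ℂ} {γ : Fin n × Fin n → ℂ}
    (hγ : (E.jacobianC (graphPoint y)).mulVec γ = 0)
    {μ : Fin n × Fin n → MvPolynomial (MatMulVars n) ℂ} (hμ : ∀ q, eval y (μ q) = γ q)
    {j : ℕ} (hj : j ∈ E.tests) {ρ : MvPolynomial (MatMulVars n) ℂ}
    (hr : derivC μ (E.testPoly j) - liftAB n ρ ∈ graphIdeal n) : eval y ρ = 0 := by
  have h := eval_eq_zero_of_mem_graphIdeal hr (graphPoint_mem_mmGraph y)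
  rwa [map_sub, eval_graphPoint_derivC_eq_zero_of_tangent hγ hμ hj, eval_graphPoint_liftAB, zero_sub,
    neg_eq_zero] at h

end EqSystem

/-! ## Transport of order-one isolation under corrections vanishing at `y` -/

/-- **TRANSPORT.**  `span S` initially isolated to order `1` over `y`, `S' ⊆ I`, and every `s ∈ S`
of the form `s' + ι σ` with `s' ∈ span S'`, `σ(y) = 0` ⇒ `span S'` initially isolated to order `1`
over `y`. -/
theorem IdealInitIsolatedSet.transport {S S' : Set (MvPolynomial (GraphVars n) ℂ)}
    {y : MatMulVars n → ℂ} (h : IdealInitIsolatedSet S 1 y) (hI : S' ⊆ (graphIdeal n : Set _))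
    (hcorr : ∀ s ∈ S, ∃ s' ∈ Ideal.span S', ∃ σ : MvPolynomial (MatMulVars n) ℂ,
      s = s' + liftAB n σ ∧ eval y σ = 0) :
    IdealInitIsolatedSet S' 1 y := by
  classical
  obtain ⟨T, u, hu, ν, G, hν, hG, hlow, hiso⟩ := h
  -- every member of `span S` has a partner in `span S'` with the same specialisation at `y`
  have key : ∀ v ∈ Ideal.span S, ∃ v' ∈ Ideal.span S',
      map (eval y) (liftF n v) = map (eval y) (liftF n v') := by
    intro v hv
    induction hv using Submodule.span_induction with
    | mem s hs =>
      obtain ⟨s', hs', σ, rfl, hσ⟩ := hcorr s hs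
      exact ⟨s', hs', by rw [map_add, map_add, liftF_liftAB, map_C, hσ, C_0, add_zero]⟩
    | zero => exact ⟨0, Ideal.zero_mem _, rfl⟩
    | add v w _ _ hv hw =>
      obtain ⟨v', hv', hvk⟩ := hv
      obtain ⟨w', hw', hwk⟩ := hw
      exact ⟨v' + w', Ideal.add_mem _ hv' hw', by rw [map_add, map_add, map_add, map_add, hvk, hwk]⟩
    | smul r v _ hv =>
      obtain ⟨v', hv', hvk⟩ := hv
      exact ⟨r * v', Ideal.mul_mem_left _ r hv',
        by rw [smul_eq_mul, map_mul, map_mul, map_mul, map_mul, hvk]⟩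
  choose u' hu' hcomp using fun i => key (u i) (hu i)
  refine ⟨T, u', hu', ν, fun i => liftF n (u' i), hν, fun i => substF_liftF _, fun i j hj => ?_,
    fun F₀ hF => hiso F₀ fun i => ?_⟩
  · obtain rfl : j = 0 := by have := hν i; omega
    exact homogeneousComponent_zero_liftF_eq_zero fun x hx =>
      eval_eq_zero_of_mem_graphIdeal (Ideal.span_le.mpr hI (hu' i)) hx
  · have hGi : G i = liftF n (u i) := by rw [← hG i, liftF_substF]
    rw [hGi, ← homogeneousComponent_map, hcomp i, homogeneousComponent_map]
    exact hF i

namespace EqSystem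

/-! ## Tangent deflation, set level -/

/-- **`deflate_tangent`, set-level form.**  For `E` correct with test ideal initially isolated to
order `2` over `y` there is a tangent `γ ∈ ker J_C(graphPoint y)` such that for every field `μ`
with `μ(y) = γ`, `span (tests ∪ D_μ tests)` is initially isolated to order `1` over `y`. -/
theorem IdealInitIsolatedAt.deflate_tangent_set {E : EqSystem n} {y : MatMulVars n → ℂ}
    (hE : E.Correct) (h : E.IdealInitIsolatedAt 2 y) :
    ∃ γ : Fin n × Fin n → ℂ, (E.jacobianC (graphPoint y)).mulVec γ = 0 ∧
      ∀ μ : Fin n × Fin n → MvPolynomial (MatMulVars n) ℂ, (∀ q, eval y (μ q) = γ q) →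
        IdealInitIsolatedSet (E.testSet ∪ derivC μ '' E.testSet) 1 y := by
  obtain ⟨T, u, hu, ν, G, hν, hG, hlow, hiso⟩ := h
  obtain ⟨v, hv⟩ : ∃ v : Fin E.tests.length → MvPolynomial (GraphVars n) ℂ,
      v = fun o => E.testPoly (E.tests.get o) := ⟨_, rfl⟩
  have hν' : ∀ o, Fin.append ν (fun _ : Fin E.tests.length => 1) o ≤ 2 := fun o => by
    induction o using Fin.addCases with
    | left o => simpa only [Fin.append_left] using hν o
    | right o => simp only [Fin.append_right]; omega
  have hG' : ∀ o, substF n (Fin.append G (fun o => liftF n (v o)) o) = Fin.append u v o := fun o => by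
    induction o using Fin.addCases with
    | left o => simp only [Fin.append_left, hG]
    | right o => simp only [Fin.append_right, substF_liftF]
  have hlow' : ∀ o, ∀ j < Fin.append ν (fun _ : Fin E.tests.length => 1) o,
      homogeneousComponent j (Fin.append G (fun o => liftF n (v o)) o) = 0 := fun o => by
    induction o using Fin.addCases with
    | left o => simpa only [Fin.append_left] using hlow o
    | right o =>
      intro j hj
      simp only [Fin.append_right] at hj ⊢
      obtain rfl : j = 0 := by omega
      rw [hv]
      exact homogeneousComponent_zero_liftF_eq_zero fun x hx => hE.eval_testPoly_eq_zero hx (List.get_mem _ _)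
  have hiso' : ∀ F₀ : Fin n × Fin n → ℂ,
      (∀ o, eval F₀ (map (eval y) (homogeneousComponent (Fin.append ν (fun _ : Fin E.tests.length => 1) o)
          (Fin.append G (fun o => liftF n (v o)) o))) =
        eval 0 (map (eval y) (homogeneousComponent (Fin.append ν (fun _ : Fin E.tests.length => 1) o)
          (Fin.append G (fun o => liftF n (v o)) o)))) → F₀ = 0 :=
    fun F₀ hF => hiso F₀ fun o => by simpa only [Fin.append_left] using hF (Fin.castAdd _ o)
  obtain ⟨γ, hγN, hγ⟩ := InitIsolatedFam.deflate_of_data _ _ hν' hG' hlow' hiso'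
  have hmem : ∀ o, Fin.append u v o ∈ Ideal.span E.testSet := fun o => by
    induction o using Fin.addCases with
    | left o => simp only [Fin.append_left]; exact hu o
    | right o => simp only [Fin.append_right, hv]; exact Ideal.subset_span ⟨o, rfl⟩
  refine ⟨γ, (E.jacobianC_graphPoint_mulVec_eq_zero_iff y γ).mpr fun j hj => ?_, fun μ hμ => ?_⟩
  · obtain ⟨o, ho⟩ := List.mem_iff_get.mp hj
    have h := hγN (Fin.natAdd T o) (by simp only [Fin.append_right])
    rw [Fin.append_right, hv] at h
    simpa only [ho] using h
  · refine ⟨_, _, fun i => ?_, hγ μ hμ⟩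
    induction i using Fin.addCases with
    | left o => simp only [Fin.append_left]; exact Ideal.span_mono Set.subset_union_left (hmem o)
    | right o =>
      simp only [Fin.append_right]
      exact derivC_mem_span μ Set.subset_union_left
        (fun t ht => Set.mem_union_right _ (Set.mem_image_of_mem _ ht)) (hmem o)

/-! ## Corrected deflation -/

/-- `E'` CONTAINS THE `ρ`-CORRECTED `μ`-DEFLATION OF `E`: every test `t_j` of `E` is a test of `E'`,
and so is every corrected derivative `D_μ t_j − ι ρ_j` that is not `0`. -/
def CorrDeflatesTo (E : EqSystem n) (μ : Fin n × Fin n → MvPolynomial (MatMulVars n) ℂ)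
    (ρ : ℕ → MvPolynomial (MatMulVars n) ℂ) (E' : EqSystem n) : Prop :=
  (∀ j ∈ E.tests, ∃ j' ∈ E'.tests, E'.testPoly j' = E.testPoly j) ∧
    (∀ j ∈ E.tests, derivC μ (E.testPoly j) - liftAB n (ρ j) = 0 ∨
      ∃ j' ∈ E'.tests, E'.testPoly j' = derivC μ (E.testPoly j) - liftAB n (ρ j))

/-- The uncorrected deflation is the case `ρ = 0`. -/
theorem DeflatesTo.corrDeflatesTo {E E' : EqSystem n} {μ : Fin n × Fin n → MvPolynomial (MatMulVars n) ℂ}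
    (h : E.DeflatesTo μ E') : E.CorrDeflatesTo μ (fun _ => 0) E' :=
  ⟨h.1, fun j hj => Or.inr (by simpa only [map_zero, sub_zero] using h.2 j hj)⟩

/-- **CORRECTED DEFLATION.**  For `E` correct with test ideal initially isolated to order `2` over `y`
there is a tangent `γ` such that for every field `μ` with `μ(y) = γ` and all corrections `ρ` with
`D_μ t_j − ι ρ_j ∈ I`, every system containing the `ρ`-corrected `μ`-deflation of `E` has its test
ideal initially isolated to order `1` over `y`. -/
theorem IdealInitIsolatedAt.deflate_corrected {E : EqSystem n} {y : MatMulVars n → ℂ} (hE : E.Correct)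
    (h : E.IdealInitIsolatedAt 2 y) :
    ∃ γ : Fin n × Fin n → ℂ, (E.jacobianC (graphPoint y)).mulVec γ = 0 ∧
      ∀ μ : Fin n × Fin n → MvPolynomial (MatMulVars n) ℂ, (∀ q, eval y (μ q) = γ q) →
        ∀ ρ : ℕ → MvPolynomial (MatMulVars n) ℂ,
          (∀ j ∈ E.tests, derivC μ (E.testPoly j) - liftAB n (ρ j) ∈ graphIdeal n) →
          ∀ E' : EqSystem n, E.CorrDeflatesTo μ ρ E' → E'.IdealInitIsolatedAt 1 y := by
  obtain ⟨γ, hγT, hset⟩ := h.deflate_tangent_set hE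
  refine ⟨γ, hγT, fun μ hμ ρ hr E' hD => ?_⟩
  have hS : IdealInitIsolatedSet {t | t ∈ E'.testSet ∧ t ∈ graphIdeal n} 1 y := by
    refine (hset μ hμ).transport (fun t ht => ht.2) fun s hs => ?_
    rcases hs with hs | ⟨t, ht, rfl⟩
    · obtain ⟨j, hj, rfl⟩ := (E.mem_testSet_iff s).mp hs
      obtain ⟨j', hj', hjj'⟩ := hD.1 j hj
      refine ⟨E.testPoly j, Ideal.subset_span ⟨(E'.mem_testSet_iff _).mpr ⟨j', hj', hjj'⟩, ?_⟩, 0,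
        by rw [map_zero, add_zero], map_zero _⟩
      exact mem_graphIdeal_of_vanishing fun x hx => hE.eval_testPoly_eq_zero hx hj
    · obtain ⟨j, hj, rfl⟩ := (E.mem_testSet_iff t).mp ht
      refine ⟨derivC μ (E.testPoly j) - liftAB n (ρ j), ?_, ρ j, (sub_add_cancel _ _).symm,
        eval_correction_eq_zero hγT hμ hj (hr j hj)⟩
      rcases hD.2 j hj with h0 | ⟨j', hj', hjj'⟩
      · rw [h0]; exact Ideal.zero_mem _
      · exact Ideal.subset_span ⟨(E'.mem_testSet_iff _).mpr ⟨j', hj', hjj'⟩, hr j hj⟩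
  exact (E'.idealInitIsolatedAt_iff 1 y).mpr (hS.mono (Ideal.span_mono fun t ht => ht.1))

/-- **A system containing the tests of a correct system, all of whose tests lie in `I`, is correct.**
(No kernel-field condition: this is what corrected deflations satisfy.) -/
theorem Correct.of_contains {E E' : EqSystem n} (hE : E.Correct) (hfan : E'.circuit.IsFanInTwo)
    (hold : ∀ j ∈ E.tests, ∃ j' ∈ E'.tests, E'.testPoly j' = E.testPoly j)
    (hI : ∀ j' ∈ E'.tests, E'.testPoly j' ∈ graphIdeal n) : E'.Correct := by
  refine ⟨hfan, Set.ext fun x => ⟨fun hx => ?_, fun hx => ?_⟩⟩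
  · rw [← hE.2]
    exact fun j hj => by obtain ⟨j', hj', he⟩ := hold j hj; rw [← he]; exact hx j' hj'
  · exact fun j' hj' => eval_eq_zero_of_mem_graphIdeal (hI j' hj') hx

/-! ## Dropping the tests outside `I` -/

open scoped Classical in
/-- The same program with only those tests kept that lie in `I` (same circuit, same cost). -/
def restrictToIdeal (E : EqSystem n) : EqSystem n where
  circuit := E.circuit
  tests := E.tests.filter fun j => decide (E.testPoly j ∈ graphIdeal n)

/-- Same test polynomials. -/
theorem restrictToIdeal_testPoly (E : EqSystem n) (j : ℕ) : E.restrictToIdeal.testPoly j = E.testPoly j := rfl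

/-- Same cost. -/
theorem restrictToIdeal_cost (E : EqSystem n) : E.restrictToIdeal.cost = E.cost := rfl

/-- The kept tests. -/
theorem mem_restrictToIdeal_tests {E : EqSystem n} {j : ℕ} :
    j ∈ E.restrictToIdeal.tests ↔ j ∈ E.tests ∧ E.testPoly j ∈ graphIdeal n := by
  classical
  simp [restrictToIdeal, List.mem_filter]

end EqSystem

/-! ## The row-split class: zero row or `c`-affine -/

/-- `t` has ZERO ROW: the `F`-linear part of `Ψ⁻¹ t` vanishes (e.g. `t ∈ I²`). -/
def ZeroRow (t : MvPolynomial (GraphVars n) ℂ) : Prop := ∀ q, coeff (Finsupp.single q 1) (liftF n t) = 0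

/-- `t` is `c`-AFFINE: all `∂t/∂c_q` lie in `ℂ[A,B]` (e.g. generator tests `f_q`, Freivalds tests
`x(a)ᵀ (C − AB) y(b)` with polynomial vectors). -/
def CAffine (t : MvPolynomial (GraphVars n) ℂ) : Prop :=
  ∃ ℓ : Fin n × Fin n → MvPolynomial (MatMulVars n) ℂ, ∀ q, pderiv (Sum.inr q) t = liftAB n (ℓ q)

/-- A zero-row test is killed modulo `I` by EVERY field: `D_μ t ∈ I`. -/
theorem ZeroRow.derivC_mem {t : MvPolynomial (GraphVars n) ℂ} (h : ZeroRow t)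
    (μ : Fin n × Fin n → MvPolynomial (MatMulVars n) ℂ) : derivC μ t ∈ graphIdeal n := by
  rw [derivC_mem_graphIdeal_iff]
  exact Finset.sum_eq_zero fun q _ => by rw [h q, mul_zero]

/-- For a `c`-affine test, `D_μ t` is already in `ℂ[A,B]`: it is its own graph restriction. -/
theorem CAffine.derivC_eq {t : MvPolynomial (GraphVars n) ℂ} (h : CAffine t)
    (μ : Fin n × Fin n → MvPolynomial (MatMulVars n) ℂ) : ∃ σ, derivC μ t = liftAB n σ := by
  obtain ⟨ℓ, hℓ⟩ := h
  refine ⟨∑ q, μ q * ℓ q, ?_⟩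
  unfold derivC
  simp only [hℓ, map_sum, map_mul]

namespace EqSystem

/-- ROW-SPLIT: every test of `E` has zero row or is `c`-affine. -/
def RowSplit (E : EqSystem n) : Prop := ∀ j ∈ E.tests, ZeroRow (E.testPoly j) ∨ CAffine (E.testPoly j)

/-- **WITNESS (row-split class), NO KERNEL FIELD.**  A CORRECT row-split system whose test ideal is
initially isolated to order `2` over `y` has a CORRECT deflation REDUCED at the graph point over `y`
of cost `≤ 4·cost E + n²`: forward-mode AD along the constant tangent field, then drop the tests
outside `I` (the deflated `c`-affine tests, whose corrected version is `0`). -/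
theorem exists_reduced_corrDeflation_of_rowSplit {E : EqSystem n} {y : MatMulVars n → ℂ}
    (hE : E.Correct) (hiso : E.IdealInitIsolatedAt 2 y) (hsplit : E.RowSplit) :
    ∃ E' : EqSystem n, E'.Correct ∧ E'.ReducedAt (graphPoint y) ∧ E'.cost ≤ 4 * E.cost + n * n := by
  classical
  obtain ⟨γ, hγT, hcorr⟩ := hiso.deflate_corrected hE
  obtain ⟨E₁, hfan, hD, -, hcost⟩ := forwardModeAD n E (constSystem γ) (fun q => C (γ q)) hE.1
    (constSystem_isFanInTwo γ) (constSystem_computes γ)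
  -- the corrections: `0` on zero-row tests, the `ℂ[A,B]`-value of `D_γ t` on `c`-affine tests
  have hρ : ∀ j : ℕ, ∃ σ : MvPolynomial (MatMulVars n) ℂ,
      (j ∈ E.tests → derivC (fun q => C (γ q)) (E.testPoly j) - liftAB n σ ∈ graphIdeal n) ∧
      (j ∈ E.tests → ¬ ZeroRow (E.testPoly j) → derivC (fun q => C (γ q)) (E.testPoly j) - liftAB n σ = 0) ∧
      (ZeroRow (E.testPoly j) → σ = 0) := by
    intro j
    by_cases hz : ZeroRow (E.testPoly j)
    · exact ⟨0, fun _ => by rw [map_zero, sub_zero]; exact hz.derivC_mem _, fun _ h => absurd hz h,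
        fun _ => rfl⟩
    by_cases hj : j ∈ E.tests
    · obtain ⟨σ, hσ⟩ := ((hsplit j hj).resolve_left hz).derivC_eq (fun q => C (γ q))
      exact ⟨σ, fun _ => by rw [hσ, sub_self]; exact Ideal.zero_mem _, fun _ _ => by rw [hσ, sub_self],
        fun h => absurd h hz⟩
    · exact ⟨0, fun h => absurd h hj, fun h => absurd h hj, fun h => absurd h hz⟩
  choose ρ hρI hρ0 hρz using hρ
  have hD' : E.CorrDeflatesTo (fun q => C (γ q)) ρ E₁.restrictToIdeal := by
    refine ⟨fun j hj => ?_, fun j hj => ?_⟩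
    · obtain ⟨j', hj', hjj'⟩ := hD.1 j hj
      refine ⟨j', mem_restrictToIdeal_tests.mpr ⟨hj', ?_⟩, hjj'⟩
      rw [hjj']
      exact mem_graphIdeal_of_vanishing fun x hx => hE.eval_testPoly_eq_zero hx hj
    · by_cases hz : ZeroRow (E.testPoly j)
      · obtain ⟨j', hj', hjj'⟩ := hD.2 j hj
        refine Or.inr ⟨j', mem_restrictToIdeal_tests.mpr ⟨hj', ?_⟩, ?_⟩
        · rw [hjj']; exact hz.derivC_mem _
        · rw [restrictToIdeal_testPoly, hjj', hρz j hz, map_zero, sub_zero]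
      · exact Or.inl (hρ0 j hj hz)
  have hiso' : E₁.restrictToIdeal.IdealInitIsolatedAt 1 y :=
    hcorr _ (fun q => eval_C _) ρ (fun j hj => hρI j hj) _ hD'
  have hE' : E₁.restrictToIdeal.Correct :=
    hE.of_contains hfan hD'.1 fun j' hj' => (mem_restrictToIdeal_tests.mp hj').2
  exact ⟨E₁.restrictToIdeal, hE', reducedAt_of_idealInitIsolatedAt_one hE' hiso',
    (restrictToIdeal_cost E₁).trans_le ((constSystem_cost γ) ▸ hcost)⟩

end EqSystem

end Summit.MatrixMultiplication.MatrixMultiplication.Theorems.GraphEquations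

end
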